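/-
Copyright (c) 2026 the pub-hodgecm-mathlib formalisation cell (harness21).  Prover seat hodgecm-mathlib-LH4-p13 (g8), req620 Track A «(D-RAM) FOUR-FRAME» squad, tier 0,
STAGE-1b (dealer LH4-plan (g13) WORD #91 «B2b-2 TWO-SLOT (GLUED) ORBIT LABELLED COUNT», LH4-p11 (g8) SPEC-B2 v1 §3): brick (L-lab-20a) «THE TWO-SLOT LABEL READ»: the
value-class label of record (★ p860257 `valueClassLabel`) of a clean-shell vertex with the sum `A` on top is the NORM SIGN of a σ-FIXED LINEAR FORM in the polarisation,
`ω(D₀·g_α + D₁·N(x)·g_β)`, where `g_α, g_β ∈ F` are the skew approximants of `α − 1`, `β − 1` divided by `t₊` — no `|2|` is lost (the trace of `α − 1` is `ϖ^{2n}`-deep).  2026-09-04.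
-/
import Summits.HodgeConjecture.HodgeConjecture.Theorems.F0P3cDyRamLabelClassOfStratum     -- ★ p860449 (this seat, (L-lab-19b)): `setOf_modelValue_latt_hnf_eq_smul_A`; brings ★ p860416, p860285, p860136, ★ (L-lab-3), ★ p859272
import Summits.HodgeConjecture.HodgeConjecture.Theorems.F0P3cDyRamLabelledOddCountDefs    -- ★ p860257 DEFS (LH4-p11 (g8)): `valueClassLabel`, `valueClassLabel_iff`
import Literature.NumberTheory.LocalFields.ValuedCompleteIsAdicComplete                   -- ★ `isAdicComplete_valuedInteger_of_completeSpace`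
import HarnessLib

/-!
# Crux `H413`, line LH4 «(D-RAM) FOUR-FRAME», STAGE-1b — (L-lab-20a) «THE TWO-SLOT LABEL READ: ω OF A FIXED LINEAR FORM IN THE POLARISATION»

Cell `hodgecm-mathlib` (D-0151), FLOOR 0, crux item H413 = `stmt-HodgeConjecture-24833`, route of record `HCCMUnconditional`; squad F0∕P3c∕LH4.  THEOREMS ONLY (no `def`, no
instance, no notation, no `sorry`, default heartbeats), ★-only imports, lane `--supports stmt-HodgeConjecture-24833`.

* §1 `exists_fixed_mul_refSkew_near_sub_one` — for `α ∈ E¹` with `|α − 1| = |ϖ|^n`: `∃ g ∈ F` with `|ϖ^{−m}((α − 1) − g·t₊)| ≤ 1` whenever `m + d ≤ 2n + 1` (★ p859272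
  `exists_skew_near_of_trace_deep` at `a = α − 1`, whose trace `−(α−1)²∕α` is `ϖ^{2n}`-deep; `g := z′∕t₊`).  `normSign_eq_one_iff_exists` (the `if` of ★ `normSign`).
* §2 HEAD **`valueClassLabel_latt_hnf_iff_normSign`** — clean-shell normalised HNF vertex `L` (★ p860285's block at `ℓ = d % 2`, `m = m*`), `T`-stable, polarisation `D`, `A` on top,
  `G ∈ F` with `A ≡ G·t₊ (mod ϖ^{m*})`: `valueClassLabel σ ϖ (α−1) (β−1) m* d L D ↔ normSign σ G = 1`; and **`valueClassLabel_latt_hnf_iff_normSign_linear`** with the linear form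
  `G = D₀·g_α + D₁·(xσx)·g_β` from §1's approximants (precision hypotheses `|ϖ^{−m*}·D₀((α−1) − g_α t₊)| ≤ 1`, `|ϖ^{−m*}·D₁N(x)((β−1) − g_β t₊)| ≤ 1`).

HONEST LABEL: count-neutral (the label read of the (β-BAL) Stage-B two-slot orbits; the class sum B2b-2∕B3 is separate).  HC_CM remains proved only modulo the printed citations
(2 remaining named inputs: hLiu418 = `stmt-HodgeConjecture-24832`, h413 = `stmt-HodgeConjecture-24833`) until rung 0 closes.
-/

noncomputable section

namespace Summit.HodgeConjecture.HodgeConjecture.Cruxes.H413.F0P3cDyRamTwoSlotLabelRead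

open Literature.NumberTheory.Automorphic Literature.NumberTheory.Automorphic.HermitianLattice Literature.NumberTheory.Automorphic.UnitaryGroup
open Literature.NumberTheory.Automorphic.UnitaryLatticeTree Literature.NumberTheory.Automorphic.UnitaryThreeFourFrame
open Literature.NumberTheory.LocalFields Literature.NumberTheory.LocalFields.WildQuadraticDatum
open Summit.HodgeConjecture.HodgeConjecture.Cruxes.H413.F0P3cDyRamFourFramePieces
open Summit.HodgeConjecture.HodgeConjecture.Cruxes.H413.F0P3cDyRamFourFrameCensusDefs
open Summit.HodgeConjecture.HodgeConjecture.Cruxes.H413.F0P3cDyRamDiagonalTorusDefs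
open Summit.HodgeConjecture.HodgeConjecture.Cruxes.H413.F0P3cDyRamLabelledOddCountDefs (valueClassLabel valueClassLabel_iff)
open Summit.HodgeConjecture.HodgeConjecture.Cruxes.H413.F0P3cDyRamSmulXPlusLabel (labelPlus_smul_xPlus_iff_exists_norm_of_congr)
open Summit.HodgeConjecture.HodgeConjecture.Cruxes.H413.F0P3cDyRamValueSetSkewLineCriterion (exists_skew_near_of_trace_deep)
open Summit.HodgeConjecture.HodgeConjecture.Cruxes.H413.F0P3cDyRamUniformizerPowerTube (v_pow_eq_exp_neg)
open Summit.HodgeConjecture.HodgeConjecture.Cruxes.H413.F0P3cDyRamHNFCrossGram (mulVec_three_mem_latt mulVec_hnf_apply v_cross_le_of_latticeInLevel_of_integral)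
open Summit.HodgeConjecture.HodgeConjecture.Cruxes.H413.F0P3cDyRamLabelClassOfStratum (setOf_modelValue_latt_hnf_eq_smul_A)
open scoped Valued WithZero Matrix MatrixGroups
open WithZero

variable {K : Type} [Field K] [Valued K ℤᵐ⁰]

/-! ## §1  The fixed approximant of `(α − 1)∕t₊`; `normSign = 1` iff a norm -/

/-- **`α − 1 ≡ g·t₊ (mod ϖ^m)` WITH `g ∈ F`, `m + d ≤ 2n + 1`.**  For `α ∈ E¹` with `|α − 1| = |ϖ|^n`: `(α − 1) + σ(α − 1) = −(α − 1)²∕α` has valuation `exp(−2n)`, so ★ p859272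
`exists_skew_near_of_trace_deep` gives a skew `z′` with `|ϖ^{−m}(α − 1 − z′)| ≤ 1`, and `g := z′·t₊⁻¹` is `σ`-fixed (`σt₊ = −t₊`).  The loss is the different `d`, not `|2|`.
[cite: Serre1979, Ch. III §3 Prop. 7] [cite: Rogawski1990, §4.9 Prop. 4.9.1 (b) p. 55] -/
theorem exists_fixed_mul_refSkew_near_sub_one {σ : K →+* K} {ϖ : K} {d t : ℕ} (hσ : ∀ x, σ (σ x) = x) (hvσ : ∀ a, Valued.v (σ a) = Valued.v a)
    (hfix : ∀ x : K, σ x = x → x ≠ 0 → ∃ n : ℤ, Valued.v x = exp (2 * n))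
    (hϖ : Valued.v ϖ = exp (-1 : ℤ)) (hd : Valued.v (ϖ - σ ϖ) = Valued.v ϖ ^ d) (ht : Valued.v (2 : K) = Valued.v ϖ ^ t)
    {α : K} (hα : α * σ α = 1) {n : ℕ} (hn : Valued.v (α - 1) = Valued.v ϖ ^ n) {m : ℕ} (hm : m + d ≤ 2 * n + 1) :
    ∃ g : K, σ g = g ∧ Valued.v ((ϖ ^ m)⁻¹ * ((α - 1) - g * ((ϖ - σ ϖ) * ((ϖ * σ ϖ) ^ ((d - d % 2) / 2))⁻¹))) ≤ 1 := by
  have hα0 : α ≠ 0 := fun h => by rw [h, zero_mul] at hα; exact zero_ne_one hα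
  have hσα : σ α = α⁻¹ := eq_inv_of_mul_eq_one_right hα
  have hvα : Valued.v α = 1 := v_eq_one_of_v_mul_map_eq_one hvσ (by rw [hα, map_one])
  have htr : (α - 1) + σ (α - 1) = -(-((α - 1) * (α - 1) * α⁻¹)) := by
    rw [map_sub, map_one, hσα, neg_neg]; field_simp; ring
  have hvs : Valued.v (-((α - 1) * (α - 1) * α⁻¹)) ≤ exp (-((2 * n : ℕ) : ℤ)) := by
    rw [Valuation.map_neg, map_mul, map_mul, map_inv₀, hvα, inv_one, mul_one, hn, ← pow_add, ← two_mul, ← map_pow, v_pow_eq_exp_neg hϖ]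
  obtain ⟨z', hσz', hz'⟩ := exists_skew_near_of_trace_deep hσ hfix hϖ hd ht htr hvs (n := n) (m := m) (by push_cast; omega) (by omega)
  have htp0 := refSkewScalar_ne_zero hvσ hϖ hd
  refine ⟨z' * ((ϖ - σ ϖ) * ((ϖ * σ ϖ) ^ ((d - d % 2) / 2))⁻¹)⁻¹, ?_, ?_⟩
  · rw [map_mul, map_inv₀, map_refSkewScalar_eq_neg hσ, hσz', inv_neg, neg_mul_neg]
  · rw [inv_mul_cancel_right₀ htp0]; exact hz'

omit [Valued K ℤᵐ⁰] in
/-- `normSign σ x = 1 ↔ ∃ z, z·σz = x` (the `if` of ★ `normSign`). [cite: Serre1979, Ch. V §3 Cor. 3] -/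
theorem normSign_eq_one_iff_exists (σ : K →+* K) (x : K) : normSign σ x = 1 ↔ ∃ z : K, z * σ z = x := by
  unfold normSign
  split_ifs with h
  · exact ⟨fun _ => h, fun _ => rfl⟩
  · exact ⟨fun h1 => absurd h1 (by norm_num), fun h' => absurd h' h⟩

/-! ## §2  HEAD — the value-class label of a clean-shell vertex with `A` on top is `ω` of a fixed representative of `A∕t₊` -/

/-- **THE TWO-SLOT LABEL READ.**  Complete `K`; clean-shell normalised HNF vertex `L` (★ p860285's block at `ℓ = d % 2`, `m = m* = d % 2 + 2d − 1`), stable under `T = diag(α, β, 1)`,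
polarisation `D`; the sum `A = D₀(α−1) + D₁σx(β−1)x` on top (`|A| = |ϖ|^{d % 2}` — every glued stratum, ★ p860449 `top_A_or_top_C`); `G ∈ F` with `A ≡ G·t₊ (mod ϖ^{m*})`.  Then
`valueClassLabel σ ϖ (α−1) (β−1) m* d L D ↔ normSign σ G = 1` — ★ p860449 `_eq_smul_A` (the value set is `valueSetMod ((A∕t₊) • X₊)`) and ★ (L-lab-3)
`labelPlus_smul_xPlus_iff_exists_norm_of_congr` (`G` is a fixed UNIT since `|A| = |t₊|`). [cite: Rogawski1990, §4.9 Prop. 4.9.1 (b) p. 55] [cite: Serre1979, Ch. V §3 Cor. 3]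
[cite: Kottwitz1986BaseChangeUnits, §1 pp. 240–241] -/
theorem valueClassLabel_latt_hnf_iff_normSign [CompleteSpace K] {σ : K →+* K} {ϖ : K} {d t : ℕ} (hDat : IsRamifiedQuadraticDatum σ ϖ d t)
    {D : Fin 3 → K} (hDσ : ∀ i, σ (D i) = D i) (hD0 : ∀ i, D i ≠ 0) {b c : ℕ} {x y z : K} (hx : Valued.v x ≤ 1) (hy : Valued.v y ≤ 1) (hz : Valued.v z ≤ 1)
    (hn : IsNormalisedLattice (latt (Matrix.of ![![1, 0, 0], ![x, ϖ ^ b, 0], ![y, z, ϖ ^ c]])))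
    (hM : IsVertexLattice σ ϖ (Matrix.diagonal D) 0 (latt (Matrix.of ![![1, 0, 0], ![x, ϖ ^ b, 0], ![y, z, ϖ ^ c]])))
    {α β : K} {N₀ n₁ n₂ n₃ : ℕ} (hE : IsElementDatum σ ϖ N₀ α β n₁ n₂ n₃) {mc : ℕ} (hℓN : d % 2 + 1 ≤ N₀) (hmN : d % 2 + 2 * d - 1 ≤ N₀)
    (hℓmc : 2 * (d % 2) + 1 ≤ mc) (hmmc : d % 2 + 2 * d - 1 + d % 2 ≤ mc)
    (hlev : LatticeInLevel ϖ (d % 2) (Matrix.diagonal ![α - 1, β - 1, 0]) (latt (Matrix.of ![![1, 0, 0], ![x, ϖ ^ b, 0], ![y, z, ϖ ^ c]])))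
    (hnlev : ¬ LatticeInLevel ϖ (d % 2 + 1) (Matrix.diagonal ![α - 1, β - 1, 0]) (latt (Matrix.of ![![1, 0, 0], ![x, ϖ ^ b, 0], ![y, z, ϖ ^ c]])))
    (hsq : LatticeInLevel ϖ mc (Matrix.diagonal ![(α - 1) * (α - 1), (β - 1) * (β - 1), 0]) (latt (Matrix.of ![![1, 0, 0], ![x, ϖ ^ b, 0], ![y, z, ϖ ^ c]])))
    {T : GL (Fin 3) K} (hT : (T : Matrix (Fin 3) (Fin 3) K) = Matrix.diagonal ![α, β, 1])
    (hTM : mapGL T (latt (Matrix.of ![![1, 0, 0], ![x, ϖ ^ b, 0], ![y, z, ϖ ^ c]])) = latt (Matrix.of ![![1, 0, 0], ![x, ϖ ^ b, 0], ![y, z, ϖ ^ c]]))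
    (hA : Valued.v (D 0 * (α - 1) + D 1 * σ x * ((β - 1) * x)) = Valued.v (ϖ ^ (d % 2)))
    {G : K} (hσG : σ G = G)
    (hG : Valued.v ((ϖ ^ (d % 2 + 2 * d - 1))⁻¹ * ((D 0 * (α - 1) + D 1 * σ x * ((β - 1) * x)) - G * ((ϖ - σ ϖ) * ((ϖ * σ ϖ) ^ ((d - d % 2) / 2))⁻¹))) ≤ 1) :
    valueClassLabel σ ϖ (α - 1) (β - 1) (d % 2 + 2 * d - 1) d (latt (Matrix.of ![![1, 0, 0], ![x, ϖ ^ b, 0], ![y, z, ϖ ^ c]])) D ↔ normSign σ G = 1 := by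
  obtain ⟨hσ, hvσ, hϖ, hfix, hdd, h1d, -⟩ := id hDat
  haveI : IsAdicComplete 𝓂[K] 𝒪[K] := isAdicComplete_valuedInteger_of_completeSpace hϖ
  have hϖ0 : ϖ ≠ 0 := (Valuation.ne_zero_iff Valued.v).1 (by rw [hϖ]; exact exp_ne_zero)
  set tp : K := (ϖ - σ ϖ) * ((ϖ * σ ϖ) ^ ((d - d % 2) / 2))⁻¹ with htpdef
  set A : K := D 0 * (α - 1) + D 1 * σ x * ((β - 1) * x) with hAdef
  have htp0 : tp ≠ 0 := refSkewScalar_ne_zero hvσ hϖ hdd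
  have htpv : Valued.v tp = exp (-((d % 2 : ℕ) : ℤ)) := v_refSkewScalar hvσ hϖ hdd
  -- `G` is a fixed unit: `|A∕t₊| = 1` and `|A∕t₊ − G| ≤ |ϖ^{m*}|∕|t₊| < 1`
  have hAt : Valued.v (A * tp⁻¹) = 1 := by
    rw [map_mul, map_inv₀, hA, v_pow_eq_exp_neg hϖ, htpv, mul_inv_cancel₀ exp_ne_zero]
  have hG1 : Valued.v G = 1 := by
    have hdiff : Valued.v (A * tp⁻¹ - G) < 1 := by
      have h1 : Valued.v ((A * tp⁻¹ - G) * tp) ≤ Valued.v (ϖ ^ (d % 2 + 2 * d - 1)) := by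
        have h := hG
        rw [show A - G * tp = (A * tp⁻¹ - G) * tp by field_simp] at h
        rw [map_mul, map_inv₀] at h
        rwa [inv_mul_le_iff₀ (zero_lt_iff.2 ((Valuation.ne_zero_iff _).2 (pow_ne_zero _ hϖ0))), mul_one] at h
      rw [map_mul, htpv, v_pow_eq_exp_neg hϖ] at h1
      have h2 : Valued.v (A * tp⁻¹ - G) ≤ exp (-(((d % 2 + 2 * d - 1 : ℕ) : ℤ))) * (exp (-((d % 2 : ℕ) : ℤ)))⁻¹ :=
        (le_mul_inv_iff₀ (zero_lt_iff.2 exp_ne_zero)).2 h1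
      refine h2.trans_lt ?_
      rw [← exp_neg, ← exp_add, ← exp_zero, exp_lt_exp]; omega
    have h := Valuation.map_add_eq_of_lt_left Valued.v (x := A * tp⁻¹) (y := -(A * tp⁻¹ - G)) (by rw [Valuation.map_neg, hAt]; exact hdiff)
    rw [show A * tp⁻¹ + -(A * tp⁻¹ - G) = G by ring, hAt] at h
    exact h
  -- the value set is `valueSetMod ((A∕t₊) • X₊)` (★ p860449), so the label is `LabelPlus ((A∕t₊) • X₊)`, i.e. the norm class of `G` (★ (L-lab-3))
  rw [valueClassLabel_iff, setOf_modelValue_latt_hnf_eq_smul_A hDat hDσ hD0 hx hy hz hn hM hE hℓN hmN hℓmc hmmc hlev hnlev hsq hT hTM hA, ← LabelPlus,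
    labelPlus_smul_xPlus_iff_exists_norm_of_congr hDat hσG hG1 (e := A * tp⁻¹) ?_, normSign_eq_one_iff_exists]
  rw [sub_mul, inv_mul_cancel_right₀ htp0]
  exact hG

/-- **THE TWO-SLOT LABEL READ, LINEAR FORM**: with §1's fixed approximants `g_α, g_β` (`|ϖ^{−m*}·D₀((α−1) − g_α t₊)| ≤ 1`, `|ϖ^{−m*}·D₁N(x)((β−1) − g_β t₊)| ≤ 1`):
`valueClassLabel σ ϖ (α−1) (β−1) m* d L D ↔ normSign σ (D₀·g_α + D₁·(xσx)·g_β) = 1` — the label is `ω` of a σ-FIXED LINEAR FORM in the polarisation `D` (on the classes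
`D = D₁·u`, `u ∈ S_F`: `ω(u₀·G₀ + u₁·G₁)`, the hypothesis shape of the two-slot twin of ★ F0P3-p01 `two_mul_labelledOddCount_eq_of_oneSlot`).
[cite: Rogawski1990, §4.9 Prop. 4.9.1 (b) p. 55] [cite: Serre1979, Ch. V §3 Cor. 3] [cite: Kottwitz1986BaseChangeUnits, §1 pp. 240–241] -/
theorem valueClassLabel_latt_hnf_iff_normSign_linear [CompleteSpace K] {σ : K →+* K} {ϖ : K} {d t : ℕ} (hDat : IsRamifiedQuadraticDatum σ ϖ d t)
    {D : Fin 3 → K} (hDσ : ∀ i, σ (D i) = D i) (hD0 : ∀ i, D i ≠ 0) {b c : ℕ} {x y z : K} (hx : Valued.v x ≤ 1) (hy : Valued.v y ≤ 1) (hz : Valued.v z ≤ 1)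
    (hn : IsNormalisedLattice (latt (Matrix.of ![![1, 0, 0], ![x, ϖ ^ b, 0], ![y, z, ϖ ^ c]])))
    (hM : IsVertexLattice σ ϖ (Matrix.diagonal D) 0 (latt (Matrix.of ![![1, 0, 0], ![x, ϖ ^ b, 0], ![y, z, ϖ ^ c]])))
    {α β : K} {N₀ n₁ n₂ n₃ : ℕ} (hE : IsElementDatum σ ϖ N₀ α β n₁ n₂ n₃) {mc : ℕ} (hℓN : d % 2 + 1 ≤ N₀) (hmN : d % 2 + 2 * d - 1 ≤ N₀)
    (hℓmc : 2 * (d % 2) + 1 ≤ mc) (hmmc : d % 2 + 2 * d - 1 + d % 2 ≤ mc)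
    (hlev : LatticeInLevel ϖ (d % 2) (Matrix.diagonal ![α - 1, β - 1, 0]) (latt (Matrix.of ![![1, 0, 0], ![x, ϖ ^ b, 0], ![y, z, ϖ ^ c]])))
    (hnlev : ¬ LatticeInLevel ϖ (d % 2 + 1) (Matrix.diagonal ![α - 1, β - 1, 0]) (latt (Matrix.of ![![1, 0, 0], ![x, ϖ ^ b, 0], ![y, z, ϖ ^ c]])))
    (hsq : LatticeInLevel ϖ mc (Matrix.diagonal ![(α - 1) * (α - 1), (β - 1) * (β - 1), 0]) (latt (Matrix.of ![![1, 0, 0], ![x, ϖ ^ b, 0], ![y, z, ϖ ^ c]])))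
    {T : GL (Fin 3) K} (hT : (T : Matrix (Fin 3) (Fin 3) K) = Matrix.diagonal ![α, β, 1])
    (hTM : mapGL T (latt (Matrix.of ![![1, 0, 0], ![x, ϖ ^ b, 0], ![y, z, ϖ ^ c]])) = latt (Matrix.of ![![1, 0, 0], ![x, ϖ ^ b, 0], ![y, z, ϖ ^ c]]))
    (hA : Valued.v (D 0 * (α - 1) + D 1 * σ x * ((β - 1) * x)) = Valued.v (ϖ ^ (d % 2)))
    {gα gβ : K} (hσgα : σ gα = gα) (hσgβ : σ gβ = gβ)
    (hgα : Valued.v ((ϖ ^ (d % 2 + 2 * d - 1))⁻¹ * (D 0 * ((α - 1) - gα * ((ϖ - σ ϖ) * ((ϖ * σ ϖ) ^ ((d - d % 2) / 2))⁻¹)))) ≤ 1)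
    (hgβ : Valued.v ((ϖ ^ (d % 2 + 2 * d - 1))⁻¹ * (D 1 * (x * σ x) * ((β - 1) - gβ * ((ϖ - σ ϖ) * ((ϖ * σ ϖ) ^ ((d - d % 2) / 2))⁻¹)))) ≤ 1) :
    valueClassLabel σ ϖ (α - 1) (β - 1) (d % 2 + 2 * d - 1) d (latt (Matrix.of ![![1, 0, 0], ![x, ϖ ^ b, 0], ![y, z, ϖ ^ c]])) D ↔
      normSign σ (D 0 * gα + D 1 * (x * σ x) * gβ) = 1 := by
  obtain ⟨hσ, -, -, -, -, -, -⟩ := id hDat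
  refine valueClassLabel_latt_hnf_iff_normSign hDat hDσ hD0 hx hy hz hn hM hE hℓN hmN hℓmc hmmc hlev hnlev hsq hT hTM hA ?_ ?_
  · rw [map_add, map_mul, map_mul, map_mul, map_mul, hDσ 0, hDσ 1, hσgα, hσgβ, hσ, mul_comm (σ x) x]
  · have key : (ϖ ^ (d % 2 + 2 * d - 1))⁻¹ * ((D 0 * (α - 1) + D 1 * σ x * ((β - 1) * x)) -
        (D 0 * gα + D 1 * (x * σ x) * gβ) * ((ϖ - σ ϖ) * ((ϖ * σ ϖ) ^ ((d - d % 2) / 2))⁻¹)) =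
        (ϖ ^ (d % 2 + 2 * d - 1))⁻¹ * (D 0 * ((α - 1) - gα * ((ϖ - σ ϖ) * ((ϖ * σ ϖ) ^ ((d - d % 2) / 2))⁻¹))) +
        (ϖ ^ (d % 2 + 2 * d - 1))⁻¹ * (D 1 * (x * σ x) * ((β - 1) - gβ * ((ϖ - σ ϖ) * ((ϖ * σ ϖ) ^ ((d - d % 2) / 2))⁻¹))) := by ring
    rw [key]
    exact (Valuation.map_add _ _ _).trans (max_le hgα hgβ)

end Summit.HodgeConjecture.HodgeConjecture.Cruxes.H413.F0P3cDyRamTwoSlotLabelRead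

end
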